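import Summits.QuantumFields.YangMills.Theorems.UnitScaleTiltProp7GramInverseFarTailOfRegPr
import Summits.QuantumFields.YangMills.Theorems.UnitScaleTiltProp7GramDifferenceRowKnit
import Summits.QuantumFields.YangMills.Theorems.UnitScaleTiltProp7LocalProjectorRowOfMemberRows
import Summits.QuantumFields.YangMills.Theorems.UnitScaleTiltProp7ComplementaryProjectorBlockDecayKnit
import Summits.QuantumFields.YangMills.Theorems.UnitScaleTiltProp7CoarseGramCoercivity
import HarnessLib

/-!
# Route `UnitScaleTilt`, crux K1 «MinimiserStabilityRegPr» (stmt-QuantumFields-19200), EX row `hGF[Lift]` (curved member) — **LOD LINE, PEN (L5″) `hloc` AT THE MEMBER: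
# THE GRAM-SIDE INSTANTIATION OF ✓`Prop7LocalProjectorRowOfMemberRows`** (routeR-w2 g13 03:15Z claim; px10 g11's (L6) assembly displays `hloc_j` per cube).  routeR-w3 g12's abstract
# `hloc` dock ✓p755439 `norm_inner_starProjection_sub_le_of_member_rows` INSTANTIATED at the member — `E := SiteL2K` (fine, level `K`, weight `c₀`), `C := SiteL2K` (coarse, level `n`,
# weight `c₁`), `b :=` px17's spike basis, the two massive-column systems `(G, T, ι∘Q″)` at a `RegPr` background `U₀` and `(G_1, T_1, ι∘Q_1)` at a second `RegPr` background `V₀` —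
# with EVERYTHING GRAM-SIDE DISCHARGED BY NAME: the Grams `M, M′` (`rfl`), their invertibility (B1 ✓`isUnit_gram_massive_columns` over (L4′) ✓`coarseGram_coercive`), the subspaces
# `K = ((ker Q″).map Δ_{U₀})ᗮ`, `K′` (B1 ✓`massive_column_mem`, ✓`orthogonal_le_span_massive_columns`) and the rewriting `K.starProjection f = f − projR Δ Q″ f`
# (B1 ✓`sub_projR_eq_starProjection_orthogonal`), the symmetry of `G` (px5 ✓`inner_massive_inverse_symm`), the global sizes `C_S = C_T = √s` (✓`norm_lift_topMean_le`, B1 ✓`norm_adjoint_le`),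
# `C_G = C_P²` (✓`norm_massive_inverse_le`), `‖M⁻¹‖, ‖M′⁻¹‖ ≤ m_B⁻²` ((L4′) read as accretivity of the Gram form, ✓`l2_opNorm_inv_le_of_accretive`), and the (RN) row by ✓p758093
# `hRN_of_rows` with the far tail ✓`sqrt_sum_normSq_far_gramInv_coords_le_of_regPr` (FILE D).  WHAT STAYS DISPLAYED is exactly px5 g11's analytic rows at the vector `f = toL2S u`:
# (RB1) `‖G f − G_1 f‖ ≤ c_G‖f‖` (✓p755265), (RB2) `‖ι(Q″(G_1 f)) − ι(Q_1(G_1 f))‖ ≤ c_Q‖f‖` (✓p755451), the (RN-near) list of ✓p757045 (`hS`, `hRB1′` on plateau-fixed vectors, the cut-off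
# algebra `hXpXt hXt`, and per `N`-supported coordinate vector `d`: `hT hXpT hτv hτu`), plus the windows `hδ hwin` (slope `μ`, at `U₀`), `hδV hwinV` and the gap `hgapV` (slope `μ′`, at `V₀`).
# RESULT ★★★ `norm_inner_projR_sub_projR_le_of_regPr`: **`‖⟪f, (f − projR Δ_{U₀} Q″ f) − (f − projR Δ_{V₀} Q_1 f)⟫‖ ≤ δP·‖f‖²`** with `δP` EXPLICIT in the lattice constants
# `√s, C_P², m_B` and the displayed letters — the `hloc` binder of ✓p754654∕✓p757454 `localComparison_of_cube[_cubeGauge]` at `U₀ := σ·U`, `V₀ := 1`, `f := D*Ỹ`.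

Cell `ym3-torus` (HUMAN RULING D-0037, YM ladder rung R3 — NOT d = 4, NOT infinite volume, NOT a mass gap, NOT Clay).  Width seat `ym-routeR-w2` gen 13.  THEOREMS ONLY (0 `def`, 0 `sorry`);
`--supports stmt-QuantumFields-19200 --as helper`, count-neutral.  HONEST LABEL (★★OWNER RULING №33 (6)): curved γ-row supplier line (LOD localisation), pen (L5″); an assembly of landed
rows; CONDITIONAL on px5's displayed rows, the windows∕gap and `n < K`; numerically `m_B⁻² ≈ 1.4·10¹⁶` at the pin multiplies every smallness (routeR-w2 g12's quantitative flag of record —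
the crux's `∃ ε₁(L)` absorbs it formally); nothing of (3.49), Thm 3.1∕3.3, `h349`, `hGF`, (L6), EX ∕ 19200 is proved here; no summit statement is proved by this seat.

WHAT IS PROVED (ns `Summit.QuantumFields.YangMills.Theorems.Prop7LocalProjectorRowMember`).
* `gram_inv_l2_opNorm_le_of_coercive` (`‖M⁻¹‖ ≤ m_B⁻²` from `m_B‖c‖ ≤ ‖G(T c)‖`), ★★★ `norm_inner_projR_sub_projR_le_of_regPr` (the member `hloc`, (RN-near) as px5's eight displayed rows),
  ★★★ `norm_inner_projR_sub_projR_le_of_opRow` (the same with (RN-near) as ONE operator row `hop` on `N`-supported spike sums — the conclusion shape of px5 g11's member knit).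

References: T. Bałaban, CMP **99** (1985) 389–434 [Balaban1985BackgroundPropagators] ((3.16) p.393, (3.20)–(3.26) pp.394–395, Thm 3.1 (3.46) p.398, (3.49) p.399, (3.105)–(3.106) p.414,
Thm 3.11 p.416).
-/

set_option autoImplicit false

noncomputable section

open scoped BigOperators Matrix.Norms.L2Operator InnerProductSpace ComplexConjugate Matrix

open Literature.MathematicalPhysics.QuantumFieldTheory.Balaban1983to89
open T4Continuum BlockAveraging
open BlockAveraging (Idx)
open B7Prop1Explicit (U1 disp)
open B5Eq118OneStroke (iterBlockOf)
open B10Eq27TorusAxialLog (holT transl)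
open B7TransferAnalyticMean (meanCLM)
open B11Eq103H1Complex (SiteL2K BondL2K projR)
open Summit.QuantumFields.YangMills.Theorems.Prop8Chart (emlIterU)
open Literature.MathematicalPhysics.QuantumFieldTheory.Balaban1983to89.T3ContinuumYM3Torus
open T3SectALandauChart (eta eta_pos bgUnits)
open T3PrintedRegularMinimiser (RegPr)
open T3PrintedRegularOrbits (sites_eq)
open T3LevelShift (siteShift)
open Summit.QuantumFields.YangMills.Theorems.Prop7SectET3Transport (periodsT3)
open Summit.QuantumFields.YangMills.Theorems.Prop7SectET3HilbertLetters (W₂ toL2S covLapSite)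
open Summit.QuantumFields.YangMills.Theorems.Prop7SiteEntryCoordinates (orthonormal_spike top_le_span_spike)
open Summit.QuantumFields.YangMills.Theorems.Prop7CoarseGramInverseDecay (norm_gram_inv_spike_le_exp_neg_tdist)
open Summit.QuantumFields.YangMills.Theorems.Prop7ComplementaryProjectorBlockDecay (norm_inner_spike_column_le)
open Summit.QuantumFields.YangMills.Theorems.Prop7GramInverseFarTailMember (sqrt_sum_normSq_far_gramInv_coords_le)

open Summit.QuantumFields.YangMills.Theorems.Prop7ComplementaryProjectorColumns (isUnit_gram_massive_columns massive_column_mem orthogonal_le_span_massive_columns sub_projR_eq_starProjection_orthogonal norm_adjoint_le)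
open Summit.QuantumFields.YangMills.Theorems.Prop7MassiveConjugateResolvent (inner_massive_inverse_symm)
open Summit.QuantumFields.YangMills.Theorems.Prop7ComplementaryProjectorBlockDecay (norm_lift_topMean_le norm_massive_inverse_le coarseCoercivity_pos)
open Summit.QuantumFields.YangMills.Theorems.Prop7CoarseGramCoercivity (coarseGram_coercive)
open Summit.QuantumFields.YangMills.Theorems.Prop7SpanProjectorGramForm (re_gram_form_eq)
open Summit.QuantumFields.YangMills.Theorems.Prop7ProjectorPerturbation (l2_opNorm_inv_le_of_accretive)
open Summit.QuantumFields.YangMills.Theorems.Prop7SiteEntryCoordinates (norm_sq_sum_smul_orthonormalBasis)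
open Summit.QuantumFields.YangMills.Theorems.Prop7LocalProjectorRowOfMemberRows (norm_inner_starProjection_sub_le_of_member_rows)
open Summit.QuantumFields.YangMills.Theorems.Prop7GramDifferenceRowKnit (hRN_of_rows)
open Summit.QuantumFields.YangMills.Theorems.Prop7GramInverseFarTailOfRegPr (sqrt_sum_normSq_far_gramInv_coords_le_of_regPr)

namespace Summit.QuantumFields.YangMills.Theorems.Prop7LocalProjectorRowMember

section Abstract

variable {E C : Type*} [NormedAddCommGroup E] [InnerProductSpace ℂ E] [NormedAddCommGroup C] [InnerProductSpace ℂ C] {m : Type*} [Fintype m] [DecidableEq m]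

/-- **(L4′) READ AS AN OPERATOR BOUND ON THE GRAM INVERSE**: for columns `v_y = B(b_y)` over an orthonormal basis `b` with Gram `M y y′ = ⟪v_y, v_{y′}⟫` and the coercivity `m_B‖c‖ ≤ ‖B c‖`
(`m_B > 0`), `M` is invertible with `‖M⁻¹‖ ≤ (m_B²)⁻¹` (`L²`-operator norm; ✓`re_gram_form_eq` + ✓`l2_opNorm_inv_le_of_accretive`). [cite: Balaban1985BackgroundPropagators, Thm 3.11 p.416] -/
theorem gram_inv_l2_opNorm_le_of_coercive (b : OrthonormalBasis m ℂ C) (B : C →ₗ[ℂ] E) {M : Matrix m m ℂ} (hM : ∀ y y', M y y' = ⟪B (b y), B (b y')⟫_ℂ)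
    {mB : ℝ} (hmB : 0 < mB) (hcoer : ∀ c : C, mB * ‖c‖ ≤ ‖B c‖) : IsUnit M.det ∧ ‖M⁻¹‖ ≤ (mB ^ 2)⁻¹ := by
  refine l2_opNorm_inv_le_of_accretive M (by positivity) fun c => ?_
  rw [re_gram_form_eq (fun y => B (b y)) hM c]
  have hsum : ∑ y, c y • B (b y) = B (∑ y, c y • b y) := by simp only [map_sum, map_smul]
  rw [hsum, ← norm_sq_sum_smul_orthonormalBasis b c, ← mul_pow]
  exact pow_le_pow_left₀ (mul_nonneg hmB.le (norm_nonneg _)) (hcoer _) 2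

end Abstract

variable (F : T3Family) {n K : ℕ} (h : n ≤ K) {c₀ c₁ : ℝ} [Fact (0 < c₀)] [Fact (0 < c₁)]
  {ε₀ : ℝ} (hε₀ : 0 < ε₀) (hε7 : 10 ^ 7 * (F.L : ℝ) ^ 3 * ε₀ ≤ 1)
  (U₀ : GaugeField (F.P K) 0 (Matrix.specialUnitaryGroup (Fin 2) ℂ)) (hreg : RegPr F n K ε₀ U₀)
  (Q'' : SiteL2K ℂ 3 (periodsT3 F K) c₀ W₂ →ₗ[ℂ] (Site (F.P K) (K - n) → Matrix (Fin 2) (Fin 2) ℂ))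
  (hseq : ∀ lam : Site (F.P K) 0 → Matrix (Fin 2) (Fin 2) ℂ, ∃ ns : (j : ℕ) → Site (F.P K) j → Matrix (Fin 2) (Fin 2) ℂ, ns 0 = lam ∧
      (∀ (j : ℕ) (y : Site (F.P K) (j + 1)), ns (j + 1) y = ns j (emb y) - meanCLM (Idx (F.P K)) (Matrix (Fin 2) (Fin 2) ℂ) fun i : Idx (F.P K) =>
        ns j (emb y) - ((holT (emlIterU j (bgUnits F K U₀)) (emb y) (stairWord i.2.1 (off i.1)) : (Matrix (Fin 2) (Fin 2) ℂ)ˣ) : Matrix (Fin 2) (Fin 2) ℂ) *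
          ns j (transl (emb y) (disp (stairWord i.2.1 (off i.1)))) * (((holT (emlIterU j (bgUnits F K U₀)) (emb y) (stairWord i.2.1 (off i.1)))⁻¹ : (Matrix (Fin 2) (Fin 2) ℂ)ˣ) : Matrix (Fin 2) (Fin 2) ℂ)) ∧
      ns (K - n) = Q'' (toL2S F K c₀ lam))
  (ι : (Site (F.P K) (K - n) → Matrix (Fin 2) (Fin 2) ℂ) →ₗ[ℂ] SiteL2K ℂ 3 (periodsT3 F n) c₁ W₂)
  (hι : ∀ c, ι c = toL2S F n c₁ (fun z => c (siteShift (sites_eq F n K h) z)))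
  (T : SiteL2K ℂ 3 (periodsT3 F n) c₁ W₂ →ₗ[ℂ] SiteL2K ℂ 3 (periodsT3 F K) c₀ W₂)
  (hT : ∀ (l : SiteL2K ℂ 3 (periodsT3 F K) c₀ W₂) (f : SiteL2K ℂ 3 (periodsT3 F n) c₁ W₂), ⟪ι (Q'' l), f⟫_ℂ = ⟪l, T f⟫_ℂ)
  {a : ℝ} (ha : 0 < a)
  (G : SiteL2K ℂ 3 (periodsT3 F K) c₀ W₂ →ₗ[ℂ] SiteL2K ℂ 3 (periodsT3 F K) c₀ W₂)
  (hAG : ∀ f, covLapSite F n K c₀ U₀ (G f) + (a : ℂ) • T (ι (Q'' (G f))) = f)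
  (hGA : ∀ u, G (covLapSite F n K c₀ U₀ u + (a : ℂ) • T (ι (Q'' u))) = u)
  (V₀ : GaugeField (F.P K) 0 (Matrix.specialUnitaryGroup (Fin 2) ℂ)) (hregV : RegPr F n K ε₀ V₀)
  (Q1 : SiteL2K ℂ 3 (periodsT3 F K) c₀ W₂ →ₗ[ℂ] (Site (F.P K) (K - n) → Matrix (Fin 2) (Fin 2) ℂ))
  (hseq1 : ∀ lam : Site (F.P K) 0 → Matrix (Fin 2) (Fin 2) ℂ, ∃ ns : (j : ℕ) → Site (F.P K) j → Matrix (Fin 2) (Fin 2) ℂ, ns 0 = lam ∧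
      (∀ (j : ℕ) (y : Site (F.P K) (j + 1)), ns (j + 1) y = ns j (emb y) - meanCLM (Idx (F.P K)) (Matrix (Fin 2) (Fin 2) ℂ) fun i : Idx (F.P K) =>
        ns j (emb y) - ((holT (emlIterU j (bgUnits F K V₀)) (emb y) (stairWord i.2.1 (off i.1)) : (Matrix (Fin 2) (Fin 2) ℂ)ˣ) : Matrix (Fin 2) (Fin 2) ℂ) *
          ns j (transl (emb y) (disp (stairWord i.2.1 (off i.1)))) * (((holT (emlIterU j (bgUnits F K V₀)) (emb y) (stairWord i.2.1 (off i.1)))⁻¹ : (Matrix (Fin 2) (Fin 2) ℂ)ˣ) : Matrix (Fin 2) (Fin 2) ℂ)) ∧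
      ns (K - n) = Q1 (toL2S F K c₀ lam))
  (T1 : SiteL2K ℂ 3 (periodsT3 F n) c₁ W₂ →ₗ[ℂ] SiteL2K ℂ 3 (periodsT3 F K) c₀ W₂)
  (hT1 : ∀ (l : SiteL2K ℂ 3 (periodsT3 F K) c₀ W₂) (f : SiteL2K ℂ 3 (periodsT3 F n) c₁ W₂), ⟪ι (Q1 l), f⟫_ℂ = ⟪l, T1 f⟫_ℂ)
  (G1 : SiteL2K ℂ 3 (periodsT3 F K) c₀ W₂ →ₗ[ℂ] SiteL2K ℂ 3 (periodsT3 F K) c₀ W₂)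
  (hAG1 : ∀ f, covLapSite F n K c₀ V₀ (G1 f) + (a : ℂ) • T1 (ι (Q1 (G1 f))) = f)
  (hGA1 : ∀ u, G1 (covLapSite F n K c₀ V₀ u + (a : ℂ) • T1 (ι (Q1 u))) = u)

include hε₀ hε7 hreg hseq hι hT ha hAG hGA hregV hseq1 hT1 hAG1 hGA1 in
set_option maxHeartbeats 400000 in
/-- ★★★ **THE (L5″) LOCAL PROJECTOR ROW `hloc` AT THE MEMBER** — ✓p755439 `norm_inner_starProjection_sub_le_of_member_rows` instantiated at px17's spike basis and the two `RegPr` systems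
`(G,T,ι∘Q″)` at `U₀`, `(G_1,T_1,ι∘Q_1)` at `V₀`, `n < K`, with the Gram-side discharged by name (module docstring) and the (RN) row by ✓p758093 `hRN_of_rows` + FILE D's far tail.
DISPLAYED (px5 g11's letters, at `f := toL2S u` with `u` supported in the blocks of `S`, cut-offs `Xp Xt : E →ₗ E`, near index set `N` with `∀ i ∉ N, ∀ z ∈ S, r ≤ tdist(z, σ i.1)`):
(RB1) `hRB1`, (RB2) `hRB2`, (RN-near) `hS hRB1' hXpXt hXt hT' hXpT hτv hτu`, windows `hδ hwin` (slope `μ`, `U₀`), `hδV hwinV hgapV` (slope `μ′`, `V₀`).  CONCLUSION: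
**`‖⟪f, (f − projR Δ_{U₀} Q″ f) − (f − projR Δ_{V₀} Q_1 f)⟫‖ ≤ δP·‖f‖²`**, `δP` the explicit polynomial below (`√s := C_S = C_T`, `C_P² := C_G`, `m_B⁻² := ‖M⁻¹‖`-bound, `τ` = FILE D's far-tail constant).
[cite: Balaban1985BackgroundPropagators, (3.20)–(3.26) pp.394–395, Thm 3.1 (3.46) p.398, (3.49) p.399, (3.105)–(3.106) p.414, Thm 3.11 p.416] -/
theorem norm_inner_projR_sub_projR_le_of_regPr (hnK : n < K) {μ μ' r : ℝ} (hμ' : 0 < μ') (hμμ' : μ' < μ)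
    {δ₁ : ℝ} (hδ₁ : 0 ≤ δ₁)
    (hδ : 3 * ((eta F n K)⁻¹) ^ 2 * (Real.exp (μ * eta F n K) - 1) ^ 2 + a * ((25 / 8) * (c₁ * ((((F.P K).L : ℝ) ^ (F.P K).d) ^ (K - n))⁻¹ / c₀)) * (Real.exp (3 * μ) - 1) ^ 2 ≤ δ₁ ^ 2)
    (hwin : Real.sqrt (max 2 (16 * c₀ * ((F.L : ℝ) ^ (K - n)) ^ 3 / (a * c₁))) * δ₁ ≤ 1 / 10)
    {δ₁' : ℝ} (hδ₁' : 0 ≤ δ₁')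
    (hδV : 3 * ((eta F n K)⁻¹) ^ 2 * (Real.exp (μ' * eta F n K) - 1) ^ 2 + a * ((25 / 8) * (c₁ * ((((F.P K).L : ℝ) ^ (F.P K).d) ^ (K - n))⁻¹ / c₀)) * (Real.exp (3 * μ') - 1) ^ 2 ≤ δ₁' ^ 2)
    (hwinV : Real.sqrt (max 2 (16 * c₀ * ((F.L : ℝ) ^ (K - n)) ^ 3 / (a * c₁))) * δ₁' ≤ 1 / 10)
    (hgapV : 3 * ((Real.sqrt (max 2 (16 * c₀ * ((F.L : ℝ) ^ (K - n)) ^ 3 / (a * c₁))) * (2 + Real.sqrt (max 2 (16 * c₀ * ((F.L : ℝ) ^ (K - n)) ^ 3 / (a * c₁))))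
          * (Real.sqrt 3 * (eta F n K)⁻¹ * (Real.exp (μ' * eta F n K) - 1) + (Real.sqrt 3 * (eta F n K)⁻¹ * (Real.exp (μ' * eta F n K) - 1)) ^ 2 + Real.sqrt a * (Real.sqrt ((25 / 8) * (c₁ * ((((F.P K).L : ℝ) ^ (F.P K).d) ^ (K - n))⁻¹ / c₀))) * (Real.exp (3 * μ') - 1) + a * (Real.sqrt ((25 / 8) * (c₁ * ((((F.P K).L : ℝ) ^ (F.P K).d) ^ (K - n))⁻¹ / c₀))) ^ 2 * (Real.exp (3 * μ') - 1) ^ 2)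
          * (8 * Real.sqrt (max 2 (16 * c₀ * ((F.L : ℝ) ^ (K - n)) ^ 3 / (a * c₁))) + 8 * Real.sqrt (max 2 (16 * c₀ * ((F.L : ℝ) ^ (K - n)) ^ 3 / (a * c₁))) ^ 2)
          * ((Real.sqrt ((25 / 8) * (c₁ * ((((F.P K).L : ℝ) ^ (F.P K).d) ^ (K - n))⁻¹ / c₀))) * (1 + (Real.exp (3 * μ') - 1))) + (max 2 (16 * c₀ * ((F.L : ℝ) ^ (K - n)) ^ 3 / (a * c₁))) * ((Real.sqrt ((25 / 8) * (c₁ * ((((F.P K).L : ℝ) ^ (F.P K).d) ^ (K - n))⁻¹ / c₀))) * (Real.exp (3 * μ') - 1)))) ^ 2 < (2 / ((1 + (25 / 8) * (c₁ * ((((F.P K).L : ℝ) ^ (F.P K).d) ^ (K - n))⁻¹ / c₀)) * (600 * (27 / 4 : ℝ) ^ 6 * (c₀ * ((F.L : ℝ) ^ 3) ^ (K - n) / c₁) + a))) ^ 2 / 2)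
    (Xp Xt : SiteL2K ℂ 3 (periodsT3 F K) c₀ W₂ →ₗ[ℂ] SiteL2K ℂ 3 (periodsT3 F K) c₀ W₂)
    {cG cQ δT δS s cG' τv τu : ℝ} (hcG : 0 ≤ cG) (hcQ : 0 ≤ cQ) (hδT : 0 ≤ δT) (hδS : 0 ≤ δS) (hs : 0 ≤ s) (hcG' : 0 ≤ cG') (hτv0 : 0 ≤ τv) (hτu0 : 0 ≤ τu)
    (hS : ∀ w : SiteL2K ℂ 3 (periodsT3 F K) c₀ W₂, ‖ι (Q1 w) - ι (Q'' w)‖ ≤ δS * ‖w‖ + s * ‖w - Xt w‖)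
    (hRB1' : ∀ hh : SiteL2K ℂ 3 (periodsT3 F K) c₀ W₂, Xp hh = hh → ‖G1 hh - G hh‖ ≤ cG' * ‖hh‖) (hXpXt : ∀ v, Xp (Xt v) = Xt v) (hXt : ∀ v : SiteL2K ℂ 3 (periodsT3 F K) c₀ W₂, ‖Xt v‖ ≤ ‖v‖)
    (N : Finset (Site (F.P n) 0 × (Fin 2 × Fin 2)))
    (hT' : ∀ d : Site (F.P n) 0 × (Fin 2 × Fin 2) → ℂ, (∀ y, y ∉ N → d y = 0) →
      ‖T1 (∑ y', d y' • (OrthonormalBasis.mk (orthonormal_spike F) (top_le_span_spike F) : OrthonormalBasis (Site (F.P n) 0 × (Fin 2 × Fin 2)) ℂ (SiteL2K ℂ 3 (periodsT3 F n) c₁ W₂)) y') - T (∑ y', d y' • (OrthonormalBasis.mk (orthonormal_spike F) (top_le_span_spike F) : OrthonormalBasis (Site (F.P n) 0 × (Fin 2 × Fin 2)) ℂ (SiteL2K ℂ 3 (periodsT3 F n) c₁ W₂)) y')‖ ≤ δT * ‖∑ y', d y' • (OrthonormalBasis.mk (orthonormal_spike F) (top_le_span_spike F) : OrthonormalBasis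 (Site (F.P n) 0 × (Fin 2 × Fin 2)) ℂ (SiteL2K ℂ 3 (periodsT3 F n) c₁ W₂)) y'‖)
    (hXpT : ∀ d : Site (F.P n) 0 × (Fin 2 × Fin 2) → ℂ, (∀ y, y ∉ N → d y = 0) → Xp (T1 (∑ y', d y' • (OrthonormalBasis.mk (orthonormal_spike F) (top_le_span_spike F) : OrthonormalBasis (Site (F.P n) 0 × (Fin 2 × Fin 2)) ℂ (SiteL2K ℂ 3 (periodsT3 F n) c₁ W₂)) y')) = T1 (∑ y', d y' • (OrthonormalBasis.mk (orthonormal_spike F) (top_le_span_spike F) : OrthonormalBasis (Site (F.P n) 0 × (Fin 2 × Fin 2)) ℂ (SiteL2K ℂ 3 (periodsT3 F n) c₁ W₂)) y'))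
    (hτv : ∀ d : Site (F.P n) 0 × (Fin 2 × Fin 2) → ℂ, (∀ y, y ∉ N → d y = 0) →
      ‖G1 (T1 (∑ y', d y' • (OrthonormalBasis.mk (orthonormal_spike F) (top_le_span_spike F) : OrthonormalBasis (Site (F.P n) 0 × (Fin 2 × Fin 2)) ℂ (SiteL2K ℂ 3 (periodsT3 F n) c₁ W₂)) y')) - Xt (G1 (T1 (∑ y', d y' • (OrthonormalBasis.mk (orthonormal_spike F) (top_le_span_spike F) : OrthonormalBasis (Site (F.P n) 0 × (Fin 2 × Fin 2)) ℂ (SiteL2K ℂ 3 (periodsT3 F n) c₁ W₂)) y')))‖ ≤ τv * ‖∑ y', d y' • (OrthonormalBasis.mk (orthonormal_spike F) (top_le_span_spike F) : OrthonormalBasis (Site (F.P n) 0 × (Fin 2 × Fin 2)) ℂ (SiteL2K ℂ 3 (periodsT3 F n) c₁ W₂)) y'‖)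
    (hτu : ∀ d : Site (F.P n) 0 × (Fin 2 × Fin 2) → ℂ, (∀ y, y ∉ N → d y = 0) →
      ‖G1 (G1 (T1 (∑ y', d y' • (OrthonormalBasis.mk (orthonormal_spike F) (top_le_span_spike F) : OrthonormalBasis (Site (F.P n) 0 × (Fin 2 × Fin 2)) ℂ (SiteL2K ℂ 3 (periodsT3 F n) c₁ W₂)) y'))) - Xt (G1 (G1 (T1 (∑ y', d y' • (OrthonormalBasis.mk (orthonormal_spike F) (top_le_span_spike F) : OrthonormalBasis (Site (F.P n) 0 × (Fin 2 × Fin 2)) ℂ (SiteL2K ℂ 3 (periodsT3 F n) c₁ W₂)) y'))))‖ ≤ τu * ‖∑ y', d y' • (OrthonormalBasis.mk (orthonormal_spike F) (top_le_span_spike F) : OrthonormalBasis (Site (F.P n) 0 × (Fin 2 × Fin 2)) ℂ (SiteL2K ℂ 3 (periodsT3 F n) c₁ W₂)) y'‖)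
    (S : Finset (Site (F.P K) (K - n))) (u : Site (F.P K) 0 → Matrix (Fin 2) (Fin 2) ℂ) (hu : ∀ x, iterBlockOf (K - n) x ∉ S → u x = 0)
    (hfar : ∀ i, i ∉ N → ∀ z ∈ S, r ≤ (Site.tdist (P := F.P K) z (siteShift (sites_eq F n K h) i.1) : ℝ))
    (hRB1 : ‖G (toL2S F K c₀ u) - G1 (toL2S F K c₀ u)‖ ≤ cG * ‖toL2S F K c₀ u‖)
    (hRB2 : ‖ι (Q'' (G1 (toL2S F K c₀ u))) - ι (Q1 (G1 (toL2S F K c₀ u)))‖ ≤ cQ * ‖toL2S F K c₀ u‖) :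
    ‖⟪toL2S F K c₀ u, (toL2S F K c₀ u - projR (covLapSite F n K c₀ U₀) Q'' (toL2S F K c₀ u)) - (toL2S F K c₀ u - projR (covLapSite F n K c₀ V₀) Q1 (toL2S F K c₀ u))⟫_ℂ‖
      ≤ ((Real.sqrt ((25 / 8) * (c₁ * ((((F.P K).L : ℝ) ^ (F.P K).d) ^ (K - n))⁻¹ / c₀)) * cG + cQ) * ((2 / ((1 + (25 / 8) * (c₁ * ((((F.P K).L : ℝ) ^ (F.P K).d) ^ (K - n))⁻¹ / c₀)) * (600 * (27 / 4 : ℝ) ^ 6 * (c₀ * ((F.L : ℝ) ^ 3) ^ (K - n) / c₁) + a))) ^ 2)⁻¹ * (Real.sqrt ((25 / 8) * (c₁ * ((((F.P K).L : ℝ) ^ (F.P K).d) ^ (K - n))⁻¹ / c₀)) * (max 2 (16 * c₀ * ((F.L : ℝ) ^ (K - n)) ^ 3 / (a * c₁)))) + (Real.sqrt ((25 / 8) * (c₁ * ((((F.P K).L : ℝ) ^ (F.P K).d) ^ (K - n))⁻¹ / c₀)) * (max 2 (16 * c₀ * ((F.L : ℝ) ^ (K - n)) ^ 3 / (a * c₁))))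 * (((2 / ((1 + (25 / 8) * (c₁ * ((((F.P K).L : ℝ) ^ (F.P K).d) ^ (K - n))⁻¹ / c₀)) * (600 * (27 / 4 : ℝ) ^ 6 * (c₀ * ((F.L : ℝ) ^ 3) ^ (K - n) / c₁) + a))) ^ 2)⁻¹ * ((δS * ((max 2 (16 * c₀ * ((F.L : ℝ) ^ (K - n)) ^ 3 / (a * c₁))) ^ 2 * Real.sqrt ((25 / 8) * (c₁ * ((((F.P K).L : ℝ) ^ (F.P K).d) ^ (K - n))⁻¹ / c₀))) + s * τu + Real.sqrt ((25 / 8) * (c₁ * ((((F.P K).L : ℝ) ^ (F.P K).d) ^ (K - n))⁻¹ / c₀)) * (cG' * ((max 2 (16 * c₀ * ((F.L : ℝ) ^ (K - n)) ^ 3 / (a * c₁))) * Real.sqrt ((25 / 8) * (c₁ * ((((F.P K).L : ℝ) ^ (F.P K).d) ^ (K - n))⁻¹ / c₀))) + 2 * (max 2 (16 * c₀ * ((F.L : ℝ) ^ (K - n)) ^ 3 / (a * c₁))) * τv + (max 2 (16 * c₀ * ((F.L : ℝ) ^ (K - n)) ^ 3 / (a * c₁))) * (cG' * Real.sqrt ((25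 / 8) * (c₁ * ((((F.P K).L : ℝ) ^ (F.P K).d) ^ (K - n))⁻¹ / c₀))) + (max 2 (16 * c₀ * ((F.L : ℝ) ^ (K - n)) ^ 3 / (a * c₁))) ^ 2 * δT)) * (((2 / ((1 + (25 / 8) * (c₁ * ((((F.P K).L : ℝ) ^ (F.P K).d) ^ (K - n))⁻¹ / c₀)) * (600 * (27 / 4 : ℝ) ^ 6 * (c₀ * ((F.L : ℝ) ^ 3) ^ (K - n) / c₁) + a))) ^ 2)⁻¹ * (Real.sqrt ((25 / 8) * (c₁ * ((((F.P K).L : ℝ) ^ (F.P K).d) ^ (K - n))⁻¹ / c₀)) * (max 2 (16 * c₀ * ((F.L : ℝ) ^ (K - n)) ^ 3 / (a * c₁))))) + (Real.sqrt ((25 / 8) * (c₁ * ((((F.P K).L : ℝ) ^ (F.P K).d) ^ (K - n))⁻¹ / c₀)) * (max 2 (16 * c₀ * ((F.L : ℝ) ^ (K - n)) ^ 3 / (a * c₁))) ^ 2 * Real.sqrt ((25 / 8) * (c₁ * ((((F.P K).L : ℝ) ^ (F.P K).d) ^ (K - n))⁻¹ / c₀)) + Real.sqrt ((25 / 8) *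 (c₁ * ((((F.P K).L : ℝ) ^ (F.P K).d) ^ (K - n))⁻¹ / c₀)) * (max 2 (16 * c₀ * ((F.L : ℝ) ^ (K - n)) ^ 3 / (a * c₁))) ^ 2 * Real.sqrt ((25 / 8) * (c₁ * ((((F.P K).L : ℝ) ^ (F.P K).d) ^ (K - n))⁻¹ / c₀))) * ((((2 / ((1 + (25 / 8) * (c₁ * ((((F.P K).L : ℝ) ^ (F.P K).d) ^ (K - n))⁻¹ / c₀)) * (600 * (27 / 4 : ℝ) ^ 6 * (c₀ * ((F.L : ℝ) ^ 3) ^ (K - n) / c₁) + a))) ^ 2 / 2 - 3 * ((Real.sqrt (max 2 (16 * c₀ * ((F.L : ℝ) ^ (K - n)) ^ 3 / (a * c₁))) * (2 + Real.sqrt (max 2 (16 * c₀ * ((F.L : ℝ) ^ (K - n)) ^ 3 / (a * c₁))))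
          * (Real.sqrt 3 * (eta F n K)⁻¹ * (Real.exp (μ' * eta F n K) - 1) + (Real.sqrt 3 * (eta F n K)⁻¹ * (Real.exp (μ' * eta F n K) - 1)) ^ 2 + Real.sqrt a * (Real.sqrt ((25 / 8) * (c₁ * ((((F.P K).L : ℝ) ^ (F.P K).d) ^ (K - n))⁻¹ / c₀))) * (Real.exp (3 * μ') - 1) + a * (Real.sqrt ((25 / 8) * (c₁ * ((((F.P K).L : ℝ) ^ (F.P K).d) ^ (K - n))⁻¹ / c₀))) ^ 2 * (Real.exp (3 * μ') - 1) ^ 2)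
          * (8 * Real.sqrt (max 2 (16 * c₀ * ((F.L : ℝ) ^ (K - n)) ^ 3 / (a * c₁))) + 8 * Real.sqrt (max 2 (16 * c₀ * ((F.L : ℝ) ^ (K - n)) ^ 3 / (a * c₁))) ^ 2)
          * ((Real.sqrt ((25 / 8) * (c₁ * ((((F.P K).L : ℝ) ^ (F.P K).d) ^ (K - n))⁻¹ / c₀))) * (1 + (Real.exp (3 * μ') - 1))) + (max 2 (16 * c₀ * ((F.L : ℝ) ^ (K - n)) ^ 3 / (a * c₁))) * ((Real.sqrt ((25 / 8) * (c₁ * ((((F.P K).L : ℝ) ^ (F.P K).d) ^ (K - n))⁻¹ / c₀))) * (Real.exp (3 * μ') - 1)))) ^ 2)⁻¹ * Real.exp (9 * μ')) * (8 * (max 2 (16 * c₀ * ((F.L : ℝ) ^ (K - n)) ^ 3 / (a * c₁))) * Real.sqrt ((25 / 8) * (c₁ * ((((F.P K).L : ℝ) ^ (F.P K).d) ^ (K - n))⁻¹ / c₀)) * Real.exp (3 * μ)) * (4 * (2 * (1 + 1 / (μ - μ'))) ^ 3) * Real.sqrt ((2 * (1 + 1 / (μ' / 2))) ^ 3 * (4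 * (2 * (1 + 1 / (μ' / 2))) ^ 3)) * Real.exp (-(μ' * r / 2))))) + (Real.sqrt ((25 / 8) * (c₁ * ((((F.P K).L : ℝ) ^ (F.P K).d) ^ (K - n))⁻¹ / c₀)) * (max 2 (16 * c₀ * ((F.L : ℝ) ^ (K - n)) ^ 3 / (a * c₁)))) * ((2 / ((1 + (25 / 8) * (c₁ * ((((F.P K).L : ℝ) ^ (F.P K).d) ^ (K - n))⁻¹ / c₀)) * (600 * (27 / 4 : ℝ) ^ 6 * (c₀ * ((F.L : ℝ) ^ 3) ^ (K - n) / c₁) + a))) ^ 2)⁻¹ * (Real.sqrt ((25 / 8) * (c₁ * ((((F.P K).L : ℝ) ^ (F.P K).d) ^ (K - n))⁻¹ / c₀)) * cG + cQ)) * ‖toL2S F K c₀ u‖ ^ 2 := by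
  haveI : CompleteSpace ((LinearMap.ker Q'').map (covLapSite F n K c₀ U₀)) := FiniteDimensional.complete ℂ _
  haveI : CompleteSpace ((LinearMap.ker Q1).map (covLapSite F n K c₀ V₀)) := FiniteDimensional.complete ℂ _
  have hc₀ : 0 < c₀ := Fact.out
  have hc₁ : 0 < c₁ := Fact.out
  -- letters
  have hGW : ∀ x y : SiteL2K ℂ 3 (periodsT3 F K) c₀ W₂, ⟪G x, y⟫_ℂ = ⟪x, G y⟫_ℂ := fun x y => (inner_massive_inverse_symm F U₀ Q'' ι T hT G hAG x y).symm
  have hG1s : ∀ x y : SiteL2K ℂ 3 (periodsT3 F K) c₀ W₂, ⟪G1 x, y⟫_ℂ = ⟪x, G1 y⟫_ℂ := fun x y => (inner_massive_inverse_symm F V₀ Q1 ι T1 hT1 G1 hAG1 x y).symm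
  have hTW : ∀ (l : SiteL2K ℂ 3 (periodsT3 F K) c₀ W₂) (c : SiteL2K ℂ 3 (periodsT3 F n) c₁ W₂), ⟪(ι ∘ₗ Q'') l, c⟫_ℂ = ⟪l, T c⟫_ℂ := fun l c => hT l c
  have hT1' : ∀ (l : SiteL2K ℂ 3 (periodsT3 F K) c₀ W₂) (c : SiteL2K ℂ 3 (periodsT3 F n) c₁ W₂), ⟪(ι ∘ₗ Q1) l, c⟫_ℂ = ⟪l, T1 c⟫_ℂ := fun l c => hT1 l c
  have hCS : (0 : ℝ) ≤ Real.sqrt ((25 / 8) * (c₁ * ((((F.P K).L : ℝ) ^ (F.P K).d) ^ (K - n))⁻¹ / c₀)) := Real.sqrt_nonneg _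
  have hCP : (0 : ℝ) ≤ (max 2 (16 * c₀ * ((F.L : ℝ) ^ (K - n)) ^ 3 / (a * c₁))) := by positivity
  have hSW : ∀ l : SiteL2K ℂ 3 (periodsT3 F K) c₀ W₂, ‖(ι ∘ₗ Q'') l‖ ≤ Real.sqrt ((25 / 8) * (c₁ * ((((F.P K).L : ℝ) ^ (F.P K).d) ^ (K - n))⁻¹ / c₀)) * ‖l‖ := norm_lift_topMean_le F h hε₀ hε7 U₀ hreg Q'' hseq ι hι
  have hS1 : ∀ l : SiteL2K ℂ 3 (periodsT3 F K) c₀ W₂, ‖(ι ∘ₗ Q1) l‖ ≤ Real.sqrt ((25 / 8) * (c₁ * ((((F.P K).L : ℝ) ^ (F.P K).d) ^ (K - n))⁻¹ / c₀)) * ‖l‖ := norm_lift_topMean_le F h hε₀ hε7 V₀ hregV Q1 hseq1 ι hι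
  have hGWb : ∀ v : SiteL2K ℂ 3 (periodsT3 F K) c₀ W₂, ‖G v‖ ≤ (max 2 (16 * c₀ * ((F.L : ℝ) ^ (K - n)) ^ 3 / (a * c₁))) * ‖v‖ := norm_massive_inverse_le F h hε₀ hε7 U₀ hreg Q'' hseq ι hι T hT ha G hAG
  have hG1b : ∀ v : SiteL2K ℂ 3 (periodsT3 F K) c₀ W₂, ‖G1 v‖ ≤ (max 2 (16 * c₀ * ((F.L : ℝ) ^ (K - n)) ^ 3 / (a * c₁))) * ‖v‖ := norm_massive_inverse_le F h hε₀ hε7 V₀ hregV Q1 hseq1 ι hι T1 hT1 ha G1 hAG1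
  have hTWb : ∀ c : SiteL2K ℂ 3 (periodsT3 F n) c₁ W₂, ‖T c‖ ≤ Real.sqrt ((25 / 8) * (c₁ * ((((F.P K).L : ℝ) ^ (F.P K).d) ^ (K - n))⁻¹ / c₀)) * ‖c‖ := norm_adjoint_le F Q'' ι T hT hCS hSW
  have hT1b : ∀ c : SiteL2K ℂ 3 (periodsT3 F n) c₁ W₂, ‖T1 c‖ ≤ Real.sqrt ((25 / 8) * (c₁ * ((((F.P K).L : ℝ) ^ (F.P K).d) ^ (K - n))⁻¹ / c₀)) * ‖c‖ := norm_adjoint_le F Q1 ι T1 hT1 hCS hS1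
  have hmB : (0 : ℝ) < (2 / ((1 + (25 / 8) * (c₁ * ((((F.P K).L : ℝ) ^ (F.P K).d) ^ (K - n))⁻¹ / c₀)) * (600 * (27 / 4 : ℝ) ^ 6 * (c₀ * ((F.L : ℝ) ^ 3) ^ (K - n) / c₁) + a))) := coarseCoercivity_pos F ha
  have hcoer := coarseGram_coercive F hnK h hε₀ hε7 U₀ hreg Q'' hseq ι hι T hT ha G hAG
  have hcoerV := coarseGram_coercive F hnK h hε₀ hε7 V₀ hregV Q1 hseq1 ι hι T1 hT1 ha G1 hAG1
  have hM : ∀ y y', (Matrix.of fun i i' : Site (F.P n) 0 × (Fin 2 × Fin 2) => ⟪G (T ((OrthonormalBasis.mk (orthonormal_spike F) (top_le_span_spike F) : OrthonormalBasis (Site (F.P n) 0 × (Fin 2 × Fin 2)) ℂ (SiteL2K ℂ 3 (periodsT3 F n) c₁ W₂)) i)), G (T ((OrthonormalBasis.mk (orthonormal_spike F) (top_le_span_spike F) : OrthonormalBasis (Site (F.P n) 0 × (Fin 2 × Fin 2)) ℂ (SiteL2K ℂ 3 (periodsT3 F n) c₁ W₂)) i'))⟫_ℂ) y y'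
      = ⟪G (T ((OrthonormalBasis.mk (orthonormal_spike F) (top_le_span_spike F) : OrthonormalBasis (Site (F.P n) 0 × (Fin 2 × Fin 2)) ℂ (SiteL2K ℂ 3 (periodsT3 F n) c₁ W₂)) y)), G (T ((OrthonormalBasis.mk (orthonormal_spike F) (top_le_span_spike F) : OrthonormalBasis (Site (F.P n) 0 × (Fin 2 × Fin 2)) ℂ (SiteL2K ℂ 3 (periodsT3 F n) c₁ W₂)) y'))⟫_ℂ := fun _ _ => rfl
  have hM' : ∀ y y', (Matrix.of fun i i' : Site (F.P n) 0 × (Fin 2 × Fin 2) => ⟪G1 (T1 ((OrthonormalBasis.mk (orthonormal_spike F) (top_le_span_spike F) : OrthonormalBasis (Site (F.P n) 0 × (Fin 2 × Fin 2)) ℂ (SiteL2K ℂ 3 (periodsT3 F n) c₁ W₂)) i)), G1 (T1 ((OrthonormalBasis.mk (orthonormal_spike F) (top_le_span_spike F) : OrthonormalBasis (Site (F.P n) 0 × (Fin 2 × Fin 2)) ℂ (SiteL2K ℂ 3 (periodsT3 F n) c₁ W₂)) i'))⟫_ℂ) y y'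
      = ⟪G1 (T1 ((OrthonormalBasis.mk (orthonormal_spike F) (top_le_span_spike F) : OrthonormalBasis (Site (F.P n) 0 × (Fin 2 × Fin 2)) ℂ (SiteL2K ℂ 3 (periodsT3 F n) c₁ W₂)) y)), G1 (T1 ((OrthonormalBasis.mk (orthonormal_spike F) (top_le_span_spike F) : OrthonormalBasis (Site (F.P n) 0 × (Fin 2 × Fin 2)) ℂ (SiteL2K ℂ 3 (periodsT3 F n) c₁ W₂)) y'))⟫_ℂ := fun _ _ => rfl
  have hNW := gram_inv_l2_opNorm_le_of_coercive (OrthonormalBasis.mk (orthonormal_spike F) (top_le_span_spike F) : OrthonormalBasis (Site (F.P n) 0 × (Fin 2 × Fin 2)) ℂ (SiteL2K ℂ 3 (periodsT3 F n) c₁ W₂)) (G ∘ₗ T) hM hmB (fun c => hcoer c)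
  have hNV := gram_inv_l2_opNorm_le_of_coercive (OrthonormalBasis.mk (orthonormal_spike F) (top_le_span_spike F) : OrthonormalBasis (Site (F.P n) 0 × (Fin 2 × Fin 2)) ℂ (SiteL2K ℂ 3 (periodsT3 F n) c₁ W₂)) (G1 ∘ₗ T1) hM' hmB (fun c => hcoerV c)
  have hν : (0 : ℝ) ≤ ((2 / ((1 + (25 / 8) * (c₁ * ((((F.P K).L : ℝ) ^ (F.P K).d) ^ (K - n))⁻¹ / c₀)) * (600 * (27 / 4 : ℝ) ^ 6 * (c₀ * ((F.L : ℝ) ^ 3) ^ (K - n) / c₁) + a))) ^ 2)⁻¹ := by positivity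
  -- the far tail (FILE D) and the (RN) row (FILE C)
  have htail := sqrt_sum_normSq_far_gramInv_coords_le_of_regPr F h hε₀ hε7 U₀ hreg Q'' hseq ι hι T hT ha G hAG V₀ hregV Q1 hseq1 T1 hT1 G1 hAG1 hμ' hμμ' hδ₁ hδ hwin
    hCS hSW hδ₁' hδV hwinV hCS hS1 hCP hG1b hmB hcoerV hgapV S u hu N hfar
  have hRN := hRN_of_rows (OrthonormalBasis.mk (orthonormal_spike F) (top_le_span_spike F) : OrthonormalBasis (Site (F.P n) 0 × (Fin 2 × Fin 2)) ℂ (SiteL2K ℂ 3 (periodsT3 F n) c₁ W₂)) G G1 T T1 (ι ∘ₗ Q'') (ι ∘ₗ Q1) Xp Xt hGW hG1s hTW hT1' hM hM' hCS hCS hCP hν hδT hδS hs hcG' hτv0 hτu0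
    hSW hS1 hGWb hG1b hTWb hT1b hS hRB1' hXpXt hXt N hT' hXpT hτv hτu hNV.2 (toL2S F K c₀ u) htail
  -- 2h
  have h2h := norm_inner_starProjection_sub_le_of_member_rows (OrthonormalBasis.mk (orthonormal_spike F) (top_le_span_spike F) : OrthonormalBasis (Site (F.P n) 0 × (Fin 2 × Fin 2)) ℂ (SiteL2K ℂ 3 (periodsT3 F n) c₁ W₂)) G G1 T T1 (ι ∘ₗ Q'') (ι ∘ₗ Q1) hGW hG1s hTW hT1' hM hM' hNW.1 hNV.1
    (((LinearMap.ker Q'').map (covLapSite F n K c₀ U₀))ᗮ) (((LinearMap.ker Q1).map (covLapSite F n K c₀ V₀))ᗮ)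
    (fun y => massive_column_mem F h U₀ Q'' ι hι T hT G hAG hGA (OrthonormalBasis.mk (orthonormal_spike F) (top_le_span_spike F) : OrthonormalBasis (Site (F.P n) 0 × (Fin 2 × Fin 2)) ℂ (SiteL2K ℂ 3 (periodsT3 F n) c₁ W₂)) y) (orthogonal_le_span_massive_columns F h U₀ Q'' ι hι T hT G hAG hGA (OrthonormalBasis.mk (orthonormal_spike F) (top_le_span_spike F) : OrthonormalBasis (Site (F.P n) 0 × (Fin 2 × Fin 2)) ℂ (SiteL2K ℂ 3 (periodsT3 F n) c₁ W₂)))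
    (fun y => massive_column_mem F h V₀ Q1 ι hι T1 hT1 G1 hAG1 hGA1 (OrthonormalBasis.mk (orthonormal_spike F) (top_le_span_spike F) : OrthonormalBasis (Site (F.P n) 0 × (Fin 2 × Fin 2)) ℂ (SiteL2K ℂ 3 (periodsT3 F n) c₁ W₂)) y) (orthogonal_le_span_massive_columns F h V₀ Q1 ι hι T1 hT1 G1 hAG1 hGA1 (OrthonormalBasis.mk (orthonormal_spike F) (top_le_span_spike F) : OrthonormalBasis (Site (F.P n) 0 × (Fin 2 × Fin 2)) ℂ (SiteL2K ℂ 3 (periodsT3 F n) c₁ W₂)))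
    hCS hCS hCP hν hν hcG hcQ hSW hS1 hGWb hG1b hNW.2 hNV.2 (toL2S F K c₀ u) hRB1 hRB2 hRN
  rw [← sub_projR_eq_starProjection_orthogonal F U₀ Q'' (toL2S F K c₀ u), ← sub_projR_eq_starProjection_orthogonal F V₀ Q1 (toL2S F K c₀ u)] at h2h
  exact h2h


include hε₀ hε7 hreg hseq hι hT ha hAG hGA hregV hseq1 hT1 hAG1 hGA1 in
set_option maxHeartbeats 400000 in
/-- ★★★ **THE (L5″) LOCAL PROJECTOR ROW `hloc` AT THE MEMBER — OPERATOR-ROW EDITION** (the (RN-near) input taken as ONE operator row `hop` on the `N`-supported spike sums — the conclusion shape of px5 g11's member knit of ✓p757045 — instead of its eight displayed rows; everything else as in `norm_inner_projR_sub_projR_le_of_regPr`). — ✓p755439 `norm_inner_starProjection_sub_le_of_member_rows` instantiated at px17's spike basis and the two `RegPr` systems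
`(G,T,ι∘Q″)` at `U₀`, `(G_1,T_1,ι∘Q_1)` at `V₀`, `n < K`, with the Gram-side discharged by name (module docstring) and the (RN) row by ✓p758093 `hRN_of_rows` + FILE D's far tail.
DISPLAYED (px5 g11's letters, at `f := toL2S u` with `u` supported in the blocks of `S`, cut-offs `Xp Xt : E →ₗ E`, near index set `N` with `∀ i ∉ N, ∀ z ∈ S, r ≤ tdist(z, σ i.1)`):
(RB1) `hRB1`, (RB2) `hRB2`, (RN-near) `hS hRB1' hXpXt hXt hT' hXpT hτv hτu`, windows `hδ hwin` (slope `μ`, `U₀`), `hδV hwinV hgapV` (slope `μ′`, `V₀`).  CONCLUSION: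
**`‖⟪f, (f − projR Δ_{U₀} Q″ f) − (f − projR Δ_{V₀} Q_1 f)⟫‖ ≤ δP·‖f‖²`**, `δP` the explicit polynomial below (`√s := C_S = C_T`, `C_P² := C_G`, `m_B⁻² := ‖M⁻¹‖`-bound, `τ` = FILE D's far-tail constant).
[cite: Balaban1985BackgroundPropagators, (3.20)–(3.26) pp.394–395, Thm 3.1 (3.46) p.398, (3.49) p.399, (3.105)–(3.106) p.414, Thm 3.11 p.416] -/
theorem norm_inner_projR_sub_projR_le_of_opRow (hnK : n < K) {μ μ' r : ℝ} (hμ' : 0 < μ') (hμμ' : μ' < μ)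
    {δ₁ : ℝ} (hδ₁ : 0 ≤ δ₁)
    (hδ : 3 * ((eta F n K)⁻¹) ^ 2 * (Real.exp (μ * eta F n K) - 1) ^ 2 + a * ((25 / 8) * (c₁ * ((((F.P K).L : ℝ) ^ (F.P K).d) ^ (K - n))⁻¹ / c₀)) * (Real.exp (3 * μ) - 1) ^ 2 ≤ δ₁ ^ 2)
    (hwin : Real.sqrt (max 2 (16 * c₀ * ((F.L : ℝ) ^ (K - n)) ^ 3 / (a * c₁))) * δ₁ ≤ 1 / 10)
    {δ₁' : ℝ} (hδ₁' : 0 ≤ δ₁')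
    (hδV : 3 * ((eta F n K)⁻¹) ^ 2 * (Real.exp (μ' * eta F n K) - 1) ^ 2 + a * ((25 / 8) * (c₁ * ((((F.P K).L : ℝ) ^ (F.P K).d) ^ (K - n))⁻¹ / c₀)) * (Real.exp (3 * μ') - 1) ^ 2 ≤ δ₁' ^ 2)
    (hwinV : Real.sqrt (max 2 (16 * c₀ * ((F.L : ℝ) ^ (K - n)) ^ 3 / (a * c₁))) * δ₁' ≤ 1 / 10)
    (hgapV : 3 * ((Real.sqrt (max 2 (16 * c₀ * ((F.L : ℝ) ^ (K - n)) ^ 3 / (a * c₁))) * (2 + Real.sqrt (max 2 (16 * c₀ * ((F.L : ℝ) ^ (K - n)) ^ 3 / (a * c₁))))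
          * (Real.sqrt 3 * (eta F n K)⁻¹ * (Real.exp (μ' * eta F n K) - 1) + (Real.sqrt 3 * (eta F n K)⁻¹ * (Real.exp (μ' * eta F n K) - 1)) ^ 2 + Real.sqrt a * (Real.sqrt ((25 / 8) * (c₁ * ((((F.P K).L : ℝ) ^ (F.P K).d) ^ (K - n))⁻¹ / c₀))) * (Real.exp (3 * μ') - 1) + a * (Real.sqrt ((25 / 8) * (c₁ * ((((F.P K).L : ℝ) ^ (F.P K).d) ^ (K - n))⁻¹ / c₀))) ^ 2 * (Real.exp (3 * μ') - 1) ^ 2)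
          * (8 * Real.sqrt (max 2 (16 * c₀ * ((F.L : ℝ) ^ (K - n)) ^ 3 / (a * c₁))) + 8 * Real.sqrt (max 2 (16 * c₀ * ((F.L : ℝ) ^ (K - n)) ^ 3 / (a * c₁))) ^ 2)
          * ((Real.sqrt ((25 / 8) * (c₁ * ((((F.P K).L : ℝ) ^ (F.P K).d) ^ (K - n))⁻¹ / c₀))) * (1 + (Real.exp (3 * μ') - 1))) + (max 2 (16 * c₀ * ((F.L : ℝ) ^ (K - n)) ^ 3 / (a * c₁))) * ((Real.sqrt ((25 / 8) * (c₁ * ((((F.P K).L : ℝ) ^ (F.P K).d) ^ (K - n))⁻¹ / c₀))) * (Real.exp (3 * μ') - 1)))) ^ 2 < (2 / ((1 + (25 / 8) * (c₁ * ((((F.P K).L : ℝ) ^ (F.P K).d) ^ (K - n))⁻¹ / c₀)) * (600 * (27 / 4 : ℝ) ^ 6 * (c₀ * ((F.L : ℝ) ^ 3) ^ (K - n) / c₁) + a))) ^ 2 / 2)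
    {cG cQ εN : ℝ} (hcG : 0 ≤ cG) (hcQ : 0 ≤ cQ) (hεN : 0 ≤ εN)
    (N : Finset (Site (F.P n) 0 × (Fin 2 × Fin 2)))
    (hop : ∀ d : Site (F.P n) 0 × (Fin 2 × Fin 2) → ℂ, (∀ y, y ∉ N → d y = 0) →
      ‖ι (Q1 (G1 (G1 (T1 (∑ y', d y' • (OrthonormalBasis.mk (orthonormal_spike F) (top_le_span_spike F) : OrthonormalBasis (Site (F.P n) 0 × (Fin 2 × Fin 2)) ℂ (SiteL2K ℂ 3 (periodsT3 F n) c₁ W₂)) y'))))) - ι (Q'' (G (G (T (∑ y', d y' • (OrthonormalBasis.mk (orthonormal_spike F) (top_le_span_spike F) : OrthonormalBasis (Site (F.P n) 0 × (Fin 2 × Fin 2)) ℂ (SiteL2K ℂ 3 (periodsT3 F n) c₁ W₂)) y')))))‖ ≤ εN * ‖∑ y', d y' • (OrthonormalBasis.mk (orthonormal_spike F) (top_le_span_spike F) : OrthonormalBasis (Site (F.P n) 0 × (Fin 2 × Fin 2)) ℂ (SiteL2K ℂ 3 (periodsT3 F n) c₁ W₂)) y'‖)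
    (S : Finset (Site (F.P K) (K - n))) (u : Site (F.P K) 0 → Matrix (Fin 2) (Fin 2) ℂ) (hu : ∀ x, iterBlockOf (K - n) x ∉ S → u x = 0)
    (hfar : ∀ i, i ∉ N → ∀ z ∈ S, r ≤ (Site.tdist (P := F.P K) z (siteShift (sites_eq F n K h) i.1) : ℝ))
    (hRB1 : ‖G (toL2S F K c₀ u) - G1 (toL2S F K c₀ u)‖ ≤ cG * ‖toL2S F K c₀ u‖)
    (hRB2 : ‖ι (Q'' (G1 (toL2S F K c₀ u))) - ι (Q1 (G1 (toL2S F K c₀ u)))‖ ≤ cQ * ‖toL2S F K c₀ u‖) :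
    ‖⟪toL2S F K c₀ u, (toL2S F K c₀ u - projR (covLapSite F n K c₀ U₀) Q'' (toL2S F K c₀ u)) - (toL2S F K c₀ u - projR (covLapSite F n K c₀ V₀) Q1 (toL2S F K c₀ u))⟫_ℂ‖
      ≤ ((Real.sqrt ((25 / 8) * (c₁ * ((((F.P K).L : ℝ) ^ (F.P K).d) ^ (K - n))⁻¹ / c₀)) * cG + cQ) * ((2 / ((1 + (25 / 8) * (c₁ * ((((F.P K).L : ℝ) ^ (F.P K).d) ^ (K - n))⁻¹ / c₀)) * (600 * (27 / 4 : ℝ) ^ 6 * (c₀ * ((F.L : ℝ) ^ 3) ^ (K - n) / c₁) + a))) ^ 2)⁻¹ * (Real.sqrt ((25 / 8) * (c₁ * ((((F.P K).L : ℝ) ^ (F.P K).d) ^ (K - n))⁻¹ / c₀)) * (max 2 (16 * c₀ * ((F.L : ℝ) ^ (K - n)) ^ 3 / (a * c₁)))) + (Real.sqrt ((25 / 8) * (c₁ * ((((F.P K).L : ℝ) ^ (F.P K).d) ^ (K - n))⁻¹ / c₀)) * (max 2 (16 * c₀ * ((F.L : ℝ) ^ (K - n)) ^ 3 / (a * c₁))))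 * (((2 / ((1 + (25 / 8) * (c₁ * ((((F.P K).L : ℝ) ^ (F.P K).d) ^ (K - n))⁻¹ / c₀)) * (600 * (27 / 4 : ℝ) ^ 6 * (c₀ * ((F.L : ℝ) ^ 3) ^ (K - n) / c₁) + a))) ^ 2)⁻¹ * (εN * (((2 / ((1 + (25 / 8) * (c₁ * ((((F.P K).L : ℝ) ^ (F.P K).d) ^ (K - n))⁻¹ / c₀)) * (600 * (27 / 4 : ℝ) ^ 6 * (c₀ * ((F.L : ℝ) ^ 3) ^ (K - n) / c₁) + a))) ^ 2)⁻¹ * (Real.sqrt ((25 / 8) * (c₁ * ((((F.P K).L : ℝ) ^ (F.P K).d) ^ (K - n))⁻¹ / c₀)) * (max 2 (16 * c₀ * ((F.L : ℝ) ^ (K - n)) ^ 3 / (a * c₁))))) + (Real.sqrt ((25 / 8) * (c₁ * ((((F.P K).L : ℝ) ^ (F.P K).d) ^ (K - n))⁻¹ / c₀)) * (max 2 (16 * c₀ * ((F.L : ℝ) ^ (K - n)) ^ 3 / (a * c₁))) ^ 2 * Real.sqrt ((25 / 8) * (c₁ * ((((F.P K).L : ℝ) ^ (F.P K).d) ^ (K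 - n))⁻¹ / c₀)) + Real.sqrt ((25 / 8) * (c₁ * ((((F.P K).L : ℝ) ^ (F.P K).d) ^ (K - n))⁻¹ / c₀)) * (max 2 (16 * c₀ * ((F.L : ℝ) ^ (K - n)) ^ 3 / (a * c₁))) ^ 2 * Real.sqrt ((25 / 8) * (c₁ * ((((F.P K).L : ℝ) ^ (F.P K).d) ^ (K - n))⁻¹ / c₀))) * ((((2 / ((1 + (25 / 8) * (c₁ * ((((F.P K).L : ℝ) ^ (F.P K).d) ^ (K - n))⁻¹ / c₀)) * (600 * (27 / 4 : ℝ) ^ 6 * (c₀ * ((F.L : ℝ) ^ 3) ^ (K - n) / c₁) + a))) ^ 2 / 2 - 3 * ((Real.sqrt (max 2 (16 * c₀ * ((F.L : ℝ) ^ (K - n)) ^ 3 / (a * c₁))) * (2 + Real.sqrt (max 2 (16 * c₀ * ((F.L : ℝ) ^ (K - n)) ^ 3 / (a * c₁))))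
          * (Real.sqrt 3 * (eta F n K)⁻¹ * (Real.exp (μ' * eta F n K) - 1) + (Real.sqrt 3 * (eta F n K)⁻¹ * (Real.exp (μ' * eta F n K) - 1)) ^ 2 + Real.sqrt a * (Real.sqrt ((25 / 8) * (c₁ * ((((F.P K).L : ℝ) ^ (F.P K).d) ^ (K - n))⁻¹ / c₀))) * (Real.exp (3 * μ') - 1) + a * (Real.sqrt ((25 / 8) * (c₁ * ((((F.P K).L : ℝ) ^ (F.P K).d) ^ (K - n))⁻¹ / c₀))) ^ 2 * (Real.exp (3 * μ') - 1) ^ 2)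
          * (8 * Real.sqrt (max 2 (16 * c₀ * ((F.L : ℝ) ^ (K - n)) ^ 3 / (a * c₁))) + 8 * Real.sqrt (max 2 (16 * c₀ * ((F.L : ℝ) ^ (K - n)) ^ 3 / (a * c₁))) ^ 2)
          * ((Real.sqrt ((25 / 8) * (c₁ * ((((F.P K).L : ℝ) ^ (F.P K).d) ^ (K - n))⁻¹ / c₀))) * (1 + (Real.exp (3 * μ') - 1))) + (max 2 (16 * c₀ * ((F.L : ℝ) ^ (K - n)) ^ 3 / (a * c₁))) * ((Real.sqrt ((25 / 8) * (c₁ * ((((F.P K).L : ℝ) ^ (F.P K).d) ^ (K - n))⁻¹ / c₀))) * (Real.exp (3 * μ') - 1)))) ^ 2)⁻¹ * Real.exp (9 * μ')) * (8 * (max 2 (16 * c₀ * ((F.L : ℝ) ^ (K - n)) ^ 3 / (a * c₁))) * Real.sqrt ((25 / 8) * (c₁ * ((((F.P K).L : ℝ) ^ (F.P K).d) ^ (K - n))⁻¹ / c₀)) * Real.exp (3 * μ)) * (4 * (2 * (1 + 1 / (μ - μ'))) ^ 3) * Real.sqrt ((2 * (1 + 1 / (μ' / 2))) ^ 3 * (4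 * (2 * (1 + 1 / (μ' / 2))) ^ 3)) * Real.exp (-(μ' * r / 2))))) + (Real.sqrt ((25 / 8) * (c₁ * ((((F.P K).L : ℝ) ^ (F.P K).d) ^ (K - n))⁻¹ / c₀)) * (max 2 (16 * c₀ * ((F.L : ℝ) ^ (K - n)) ^ 3 / (a * c₁)))) * ((2 / ((1 + (25 / 8) * (c₁ * ((((F.P K).L : ℝ) ^ (F.P K).d) ^ (K - n))⁻¹ / c₀)) * (600 * (27 / 4 : ℝ) ^ 6 * (c₀ * ((F.L : ℝ) ^ 3) ^ (K - n) / c₁) + a))) ^ 2)⁻¹ * (Real.sqrt ((25 / 8) * (c₁ * ((((F.P K).L : ℝ) ^ (F.P K).d) ^ (K - n))⁻¹ / c₀)) * cG + cQ)) * ‖toL2S F K c₀ u‖ ^ 2 := by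
  haveI : CompleteSpace ((LinearMap.ker Q'').map (covLapSite F n K c₀ U₀)) := FiniteDimensional.complete ℂ _
  haveI : CompleteSpace ((LinearMap.ker Q1).map (covLapSite F n K c₀ V₀)) := FiniteDimensional.complete ℂ _
  have hc₀ : 0 < c₀ := Fact.out
  have hc₁ : 0 < c₁ := Fact.out
  -- letters
  have hGW : ∀ x y : SiteL2K ℂ 3 (periodsT3 F K) c₀ W₂, ⟪G x, y⟫_ℂ = ⟪x, G y⟫_ℂ := fun x y => (inner_massive_inverse_symm F U₀ Q'' ι T hT G hAG x y).symm
  have hG1s : ∀ x y : SiteL2K ℂ 3 (periodsT3 F K) c₀ W₂, ⟪G1 x, y⟫_ℂ = ⟪x, G1 y⟫_ℂ := fun x y => (inner_massive_inverse_symm F V₀ Q1 ι T1 hT1 G1 hAG1 x y).symm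
  have hTW : ∀ (l : SiteL2K ℂ 3 (periodsT3 F K) c₀ W₂) (c : SiteL2K ℂ 3 (periodsT3 F n) c₁ W₂), ⟪(ι ∘ₗ Q'') l, c⟫_ℂ = ⟪l, T c⟫_ℂ := fun l c => hT l c
  have hT1' : ∀ (l : SiteL2K ℂ 3 (periodsT3 F K) c₀ W₂) (c : SiteL2K ℂ 3 (periodsT3 F n) c₁ W₂), ⟪(ι ∘ₗ Q1) l, c⟫_ℂ = ⟪l, T1 c⟫_ℂ := fun l c => hT1 l c
  have hCS : (0 : ℝ) ≤ Real.sqrt ((25 / 8) * (c₁ * ((((F.P K).L : ℝ) ^ (F.P K).d) ^ (K - n))⁻¹ / c₀)) := Real.sqrt_nonneg _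
  have hCP : (0 : ℝ) ≤ (max 2 (16 * c₀ * ((F.L : ℝ) ^ (K - n)) ^ 3 / (a * c₁))) := by positivity
  have hSW : ∀ l : SiteL2K ℂ 3 (periodsT3 F K) c₀ W₂, ‖(ι ∘ₗ Q'') l‖ ≤ Real.sqrt ((25 / 8) * (c₁ * ((((F.P K).L : ℝ) ^ (F.P K).d) ^ (K - n))⁻¹ / c₀)) * ‖l‖ := norm_lift_topMean_le F h hε₀ hε7 U₀ hreg Q'' hseq ι hι
  have hS1 : ∀ l : SiteL2K ℂ 3 (periodsT3 F K) c₀ W₂, ‖(ι ∘ₗ Q1) l‖ ≤ Real.sqrt ((25 / 8) * (c₁ * ((((F.P K).L : ℝ) ^ (F.P K).d) ^ (K - n))⁻¹ / c₀)) * ‖l‖ := norm_lift_topMean_le F h hε₀ hε7 V₀ hregV Q1 hseq1 ι hι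
  have hGWb : ∀ v : SiteL2K ℂ 3 (periodsT3 F K) c₀ W₂, ‖G v‖ ≤ (max 2 (16 * c₀ * ((F.L : ℝ) ^ (K - n)) ^ 3 / (a * c₁))) * ‖v‖ := norm_massive_inverse_le F h hε₀ hε7 U₀ hreg Q'' hseq ι hι T hT ha G hAG
  have hG1b : ∀ v : SiteL2K ℂ 3 (periodsT3 F K) c₀ W₂, ‖G1 v‖ ≤ (max 2 (16 * c₀ * ((F.L : ℝ) ^ (K - n)) ^ 3 / (a * c₁))) * ‖v‖ := norm_massive_inverse_le F h hε₀ hε7 V₀ hregV Q1 hseq1 ι hι T1 hT1 ha G1 hAG1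
  have hTWb : ∀ c : SiteL2K ℂ 3 (periodsT3 F n) c₁ W₂, ‖T c‖ ≤ Real.sqrt ((25 / 8) * (c₁ * ((((F.P K).L : ℝ) ^ (F.P K).d) ^ (K - n))⁻¹ / c₀)) * ‖c‖ := norm_adjoint_le F Q'' ι T hT hCS hSW
  have hT1b : ∀ c : SiteL2K ℂ 3 (periodsT3 F n) c₁ W₂, ‖T1 c‖ ≤ Real.sqrt ((25 / 8) * (c₁ * ((((F.P K).L : ℝ) ^ (F.P K).d) ^ (K - n))⁻¹ / c₀)) * ‖c‖ := norm_adjoint_le F Q1 ι T1 hT1 hCS hS1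
  have hmB : (0 : ℝ) < (2 / ((1 + (25 / 8) * (c₁ * ((((F.P K).L : ℝ) ^ (F.P K).d) ^ (K - n))⁻¹ / c₀)) * (600 * (27 / 4 : ℝ) ^ 6 * (c₀ * ((F.L : ℝ) ^ 3) ^ (K - n) / c₁) + a))) := coarseCoercivity_pos F ha
  have hcoer := coarseGram_coercive F hnK h hε₀ hε7 U₀ hreg Q'' hseq ι hι T hT ha G hAG
  have hcoerV := coarseGram_coercive F hnK h hε₀ hε7 V₀ hregV Q1 hseq1 ι hι T1 hT1 ha G1 hAG1
  have hM : ∀ y y', (Matrix.of fun i i' : Site (F.P n) 0 × (Fin 2 × Fin 2) => ⟪G (T ((OrthonormalBasis.mk (orthonormal_spike F) (top_le_span_spike F) : OrthonormalBasis (Site (F.P n) 0 × (Fin 2 × Fin 2)) ℂ (SiteL2K ℂ 3 (periodsT3 F n) c₁ W₂)) i)), G (T ((OrthonormalBasis.mk (orthonormal_spike F) (top_le_span_spike F) : OrthonormalBasis (Site (F.P n) 0 × (Fin 2 × Fin 2)) ℂ (SiteL2K ℂ 3 (periodsT3 F n) c₁ W₂)) i'))⟫_ℂ) y y'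
      = ⟪G (T ((OrthonormalBasis.mk (orthonormal_spike F) (top_le_span_spike F) : OrthonormalBasis (Site (F.P n) 0 × (Fin 2 × Fin 2)) ℂ (SiteL2K ℂ 3 (periodsT3 F n) c₁ W₂)) y)), G (T ((OrthonormalBasis.mk (orthonormal_spike F) (top_le_span_spike F) : OrthonormalBasis (Site (F.P n) 0 × (Fin 2 × Fin 2)) ℂ (SiteL2K ℂ 3 (periodsT3 F n) c₁ W₂)) y'))⟫_ℂ := fun _ _ => rfl
  have hM' : ∀ y y', (Matrix.of fun i i' : Site (F.P n) 0 × (Fin 2 × Fin 2) => ⟪G1 (T1 ((OrthonormalBasis.mk (orthonormal_spike F) (top_le_span_spike F) : OrthonormalBasis (Site (F.P n) 0 × (Fin 2 × Fin 2)) ℂ (SiteL2K ℂ 3 (periodsT3 F n) c₁ W₂)) i)), G1 (T1 ((OrthonormalBasis.mk (orthonormal_spike F) (top_le_span_spike F) : OrthonormalBasis (Site (F.P n) 0 × (Fin 2 × Fin 2)) ℂ (SiteL2K ℂ 3 (periodsT3 F n) c₁ W₂)) i'))⟫_ℂ) y y'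
      = ⟪G1 (T1 ((OrthonormalBasis.mk (orthonormal_spike F) (top_le_span_spike F) : OrthonormalBasis (Site (F.P n) 0 × (Fin 2 × Fin 2)) ℂ (SiteL2K ℂ 3 (periodsT3 F n) c₁ W₂)) y)), G1 (T1 ((OrthonormalBasis.mk (orthonormal_spike F) (top_le_span_spike F) : OrthonormalBasis (Site (F.P n) 0 × (Fin 2 × Fin 2)) ℂ (SiteL2K ℂ 3 (periodsT3 F n) c₁ W₂)) y'))⟫_ℂ := fun _ _ => rfl
  have hNW := gram_inv_l2_opNorm_le_of_coercive (OrthonormalBasis.mk (orthonormal_spike F) (top_le_span_spike F) : OrthonormalBasis (Site (F.P n) 0 × (Fin 2 × Fin 2)) ℂ (SiteL2K ℂ 3 (periodsT3 F n) c₁ W₂)) (G ∘ₗ T) hM hmB (fun c => hcoer c)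
  have hNV := gram_inv_l2_opNorm_le_of_coercive (OrthonormalBasis.mk (orthonormal_spike F) (top_le_span_spike F) : OrthonormalBasis (Site (F.P n) 0 × (Fin 2 × Fin 2)) ℂ (SiteL2K ℂ 3 (periodsT3 F n) c₁ W₂)) (G1 ∘ₗ T1) hM' hmB (fun c => hcoerV c)
  have hν : (0 : ℝ) ≤ ((2 / ((1 + (25 / 8) * (c₁ * ((((F.P K).L : ℝ) ^ (F.P K).d) ^ (K - n))⁻¹ / c₀)) * (600 * (27 / 4 : ℝ) ^ 6 * (c₀ * ((F.L : ℝ) ^ 3) ^ (K - n) / c₁) + a))) ^ 2)⁻¹ := by positivity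
  -- the far tail (FILE D) and the (RN) row (FILE C)
  have htail := sqrt_sum_normSq_far_gramInv_coords_le_of_regPr F h hε₀ hε7 U₀ hreg Q'' hseq ι hι T hT ha G hAG V₀ hregV Q1 hseq1 T1 hT1 G1 hAG1 hμ' hμμ' hδ₁ hδ hwin
    hCS hSW hδ₁' hδV hwinV hCS hS1 hCP hG1b hmB hcoerV hgapV S u hu N hfar
  have hRN := Prop7GramDifferenceRowSum.hRN_of_near_far (OrthonormalBasis.mk (orthonormal_spike F) (top_le_span_spike F) : OrthonormalBasis (Site (F.P n) 0 × (Fin 2 × Fin 2)) ℂ (SiteL2K ℂ 3 (periodsT3 F n) c₁ W₂)) G G1 T T1 (ι ∘ₗ Q'') (ι ∘ₗ Q1) hGW hG1s hTW hT1' hM hM'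
    hCS hCP hCS hCS hCP hCS hν hSW hGWb hTWb hS1 hG1b hT1b hNV.2 N hεN
    (Prop7GramDifferenceRowSum.hnear_of_operator_row (OrthonormalBasis.mk (orthonormal_spike F) (top_le_span_spike F) : OrthonormalBasis (Site (F.P n) 0 × (Fin 2 × Fin 2)) ℂ (SiteL2K ℂ 3 (periodsT3 F n) c₁ W₂)) G G1 T T1 (ι ∘ₗ Q'') (ι ∘ₗ Q1) hGW hG1s hTW hT1' hM hM' N hop) (toL2S F K c₀ u) htail
  -- 2h
  have h2h := norm_inner_starProjection_sub_le_of_member_rows (OrthonormalBasis.mk (orthonormal_spike F) (top_le_span_spike F) : OrthonormalBasis (Site (F.P n) 0 × (Fin 2 × Fin 2)) ℂ (SiteL2K ℂ 3 (periodsT3 F n) c₁ W₂)) G G1 T T1 (ι ∘ₗ Q'') (ι ∘ₗ Q1) hGW hG1s hTW hT1' hM hM' hNW.1 hNV.1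
    (((LinearMap.ker Q'').map (covLapSite F n K c₀ U₀))ᗮ) (((LinearMap.ker Q1).map (covLapSite F n K c₀ V₀))ᗮ)
    (fun y => massive_column_mem F h U₀ Q'' ι hι T hT G hAG hGA (OrthonormalBasis.mk (orthonormal_spike F) (top_le_span_spike F) : OrthonormalBasis (Site (F.P n) 0 × (Fin 2 × Fin 2)) ℂ (SiteL2K ℂ 3 (periodsT3 F n) c₁ W₂)) y) (orthogonal_le_span_massive_columns F h U₀ Q'' ι hι T hT G hAG hGA (OrthonormalBasis.mk (orthonormal_spike F) (top_le_span_spike F) : OrthonormalBasis (Site (F.P n) 0 × (Fin 2 × Fin 2)) ℂ (SiteL2K ℂ 3 (periodsT3 F n) c₁ W₂)))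
    (fun y => massive_column_mem F h V₀ Q1 ι hι T1 hT1 G1 hAG1 hGA1 (OrthonormalBasis.mk (orthonormal_spike F) (top_le_span_spike F) : OrthonormalBasis (Site (F.P n) 0 × (Fin 2 × Fin 2)) ℂ (SiteL2K ℂ 3 (periodsT3 F n) c₁ W₂)) y) (orthogonal_le_span_massive_columns F h V₀ Q1 ι hι T1 hT1 G1 hAG1 hGA1 (OrthonormalBasis.mk (orthonormal_spike F) (top_le_span_spike F) : OrthonormalBasis (Site (F.P n) 0 × (Fin 2 × Fin 2)) ℂ (SiteL2K ℂ 3 (periodsT3 F n) c₁ W₂)))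
    hCS hCS hCP hν hν hcG hcQ hSW hS1 hGWb hG1b hNW.2 hNV.2 (toL2S F K c₀ u) hRB1 hRB2 hRN
  rw [← sub_projR_eq_starProjection_orthogonal F U₀ Q'' (toL2S F K c₀ u), ← sub_projR_eq_starProjection_orthogonal F V₀ Q1 (toL2S F K c₀ u)] at h2h
  exact h2h

end Summit.QuantumFields.YangMills.Theorems.Prop7LocalProjectorRowMember

end
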